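import Literature.Probability.FitznerVanDerHofstad2017.NobleAssumptions
import Literature.Probability.FitznerVanDerHofstad2017.Stage1Tails
import HarnessLib

/-!
# [FvdH17] Remark 2.3 / Prop. 5.5–5.6 summed over `N`: from per-`N` diagrammatic bounds to the `Σ_N Σ_x` fields of [NoBLE17] Assumption 4.3 — PROVED in abstract form

Source: R. Fitzner, R. van der Hofstad, *Mean-field behavior for nearest-neighbor percolation in `d > 10`*,
Electron. J. Probab. **22** (2017) no. 43 [FvdH17]; page / equation numbers of the extended version arXiv:1506.07977v2.
Remark 2.3 "Matrix-valued bounds" (v2 pp. 12–13): "For example, our proof yields that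
`Ξ̂^{(N)}_p(0) ≤ P⃗^S (B^ι)^{N−1} Ā^ι P⃗^E`, for `N ≥ 2`, see (5.34) … For our analysis we require a bound on this when
summed over `N`. To compute this bound numerically, we perform an eigenvector decomposition of `P⃗^S` … Then,
`Ξ̂^{(N)}_p(0) ≤ Σ_{i=1}^3 v⃗_i λ_i^{N−1} Ā^ι P⃗^E`. The sum of this over `N` is computed using the geometric sum".
Proposition 5.5 (5.34) / Proposition 5.6 (5.37) (v2 p. 53): "`Ξ̂^{(N)}_p(0) ≤ P⃗^S (B^ι)^{N−1} Ā^ι P⃗^E`",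
"`Ξ̂^{(N),ι}_p(0) ≤ P⃗^ι (B^ι)^{N−1} Ā^ι P⃗^E`".  The accompanying notebook `Percolation.nb` [FvdHnb] evaluates these
`N`-sums as (cell 41, transcript HOME/b2b-lace-num3/published/Percolation.txt l.1139–1142)
`Bound[Xi,EvenTail,s] = Bound[Xi,2,s] + Σ_j e_j³/(1−e_j²) v_j.AiotabarNonRep.PE`,
`Bound[Xi,OddTail,s] = Bound[Xi,3,s] + Σ_j e_j⁴/(1−e_j²) v_j.AiotabarNonRep.PE` (and alike for `XiIota`), and
(cell 43, l.1183–1185) `Bound[Xi,Even,s] = Bound[Xi,0,s] + Bound[Xi,EvenTail,s]`, `Bound[Xi,Odd,s] = Bound[Xi,1,s] +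
Bound[Xi,OddTail,s]`, `Bound[Xi,Absolut,s] = Bound[Xi,Odd,s] + Bound[Xi,Even,s]`.  The target shape is the one in
which [NoBLE17] Assumption 4.3 is typed in this tree (`NobleAssumptions.NSumLE`, `NobleAssumption43At`): "`Σ_N Σ_x
f^{(N)}(x) ≤ β`" = every `f^{(N)}` summable, the sequence of `x`-sums summable, the double sum `≤ β`
(R. Fitzner, R. van der Hofstad, *Generalized approach to the non-backtracking lace expansion*, Probab. Theory Relat.
Fields **169** (2017) 1041–1119 [NoBLE17], Assumption 4.3 (4.31)–(4.33), p. 1086, with "we assume that `Σ_N β^{(N)} < ∞`").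

What this module proves — everything is kernel-checked; NOTHING here is a cited hypothesis, no dimension is fixed, no
numeral of the notebooks occurs.  It is the bookkeeping between three typed objects of the tree:
(a) the OUTPUT SHAPE of the summation engine `BlockSummation*` (lean1-g13): for one `N`, a real `x`-space-summed bound
    `Summable (F_N ·) ∧ Σ'_x F_N(x) ≤ u ⬝ᵥ ((B^{M} * A * B̄^{m}) *ᵥ w)` (`BlockSummationMajorant.tsum_toReal_le_of_xSpaceBound_of_majorants`,
    with `M = N − 1`, `m = 0` for (5.34)/(5.37));
(b) the SERIES `Stage1Tails.ser drop ψ χ u B α M B̄ β w = Σ'_{(a,b)} coef(a,b) · uᵀ B^α (B²)^a M (B̄²)^b B̄^β w` and its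
    closed-form majorant under the Neumann certificate `(1 − B²) S = 1`, `0 ≤ S` (`Stage1Tails.ser_le`, `cert_one`,
    `cert_delta`) — the reading of the cell-41 symbol `Σ_j e_j^α/(1−e_j²) v_j.M.w` WITHOUT eigenvectors;
(c) the FIELD SHAPE `NSumLE f β` of `NobleAssumption43At`.
Provided:
* `NSumLE_of_perN` — a non-negative family with per-index bounds `Σ'_x F_k(x) ≤ t_k` and `t` summable satisfies
  `NSumLE F (Σ'_k t_k)` [folklore];
* `NSumLE_cons` — prepending one explicit cell: `SumLE (F 0) c` and `NSumLE (k ↦ F (k+1)) b` give `NSumLE F (c + b)`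
  (cell 43/44: `EvenTail = Bound[Xi,2] + (N ≥ 4 even)`, `Even = Bound[Xi,0] + EvenTail`, …);
* `term_zero_eq`, `ser_kDelta_eq_tsum`, `summable_term_zero` — with `χ = [b = 0]` (`kDelta`, "a side on which no
  geometric sum is taken") the double series (b) IS the single parity series `Σ'_a uᵀ B^{α+2a} A B̄^β w`, and it
  converges under the certificate;
* `NSumLE_of_parityBounds` — THE GLUE: per-`N` bounds of shape (a) along an arithmetic progression of step two,
  `Σ'_x G_a(x) ≤ u ⬝ᵥ ((B^{α+2a} * A * B̄^β) *ᵥ w)` for all `a`, with entrywise non-negative ingredients and the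
  certificate, give `NSumLE G (ser false kOne kDelta u B α A B̄ β w)` and the closed form
  `ser … ≤ u ⬝ᵥ ((B^α * (S * A) * B̄^β) *ᵥ w)` (`= Reading.closed S S̄` of the one-piece tables `Tail.xiEven` (α = 3),
  `Tail.xiOdd` (α = 4), `Tail.xiIotaEven`, `Tail.xiIotaOdd` of `Stage1Tails`; dictionary: even `N = 2a + 4 ↦ B^{N−1} =
  B^{3+2a}`, odd `N = 2a + 5 ↦ B^{4+2a}`);
* `NSumLE_tail_of_parityBounds` — the two combined: the `…Tail` fields (`k ↦ Ξ^{(2k+2)}`: `k = 0` an explicit cell,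
  `k ≥ 1` the parity series).
NOT in this module: the per-`N` bounds themselves (Lemma 6.1 / Props. 5.5–5.6 for the percolation blocks), the
weighted rows ((5.35)–(5.36), (5.38)–(5.41): tables `Tail.xiEvenDelta`, … with both kinds `one/lin` on both sides),
any numerical instantiation, and the interleaving `Absolut = Odd + Even` (in tree: `NobleKSpaceRewritePhi.NSumLE_of_even_odd`).

## References
* [FvdH17] arXiv:1506.07977v2: Remark 2.3 (pp. 12–13), Prop. 5.5 (5.34), Prop. 5.6 (5.37) (p. 53).
* [NoBLE17] PTRF 169 (2017): Assumption 4.3 (4.31)–(4.33) (p. 1086), (4.49) (p. 1088).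
* [FvdHnb] `Percolation.nb` cells 41, 43, 44 (transcript l.1139–1142, l.1183–1185, l.1214–1237).
-/

noncomputable section

namespace Literature.Probability.FitznerVanDerHofstad2017.NobleNSums

open Literature.Probability.LatticeModels Literature.Probability.Percolation
open Literature.Probability.FitznerVanDerHofstad2017 Stage1Tails EigenTails
open scoped BigOperators Matrix

/-! ## `NSumLE` from per-index bounds -/

section PerN

variable {d : ℕ}

/-- A non-negative family with per-index real bounds `Σ'_x F_k(x) ≤ t_k` and a summable majorant `t` satisfies
`NSumLE F (Σ'_k t_k)` ("`Σ_N β^{(N)} < ∞`"). [folklore] -/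
theorem NSumLE_of_perN {F : ℕ → Site d → ℝ} (h0 : ∀ k x, 0 ≤ F k x) {t : ℕ → ℝ}
    (hF : ∀ k, Summable (F k) ∧ ∑' x, F k x ≤ t k) (ht : Summable t) : NSumLE F (∑' k, t k) := by
  have hN : Summable fun k => ∑' x, F k x :=
    Summable.of_nonneg_of_le (fun k => tsum_nonneg (h0 k)) (fun k => (hF k).2) ht
  exact ⟨fun k => (hF k).1, hN, hN.tsum_le_tsum (fun k => (hF k).2) ht⟩

/-- Prepending one explicit cell: `Σ_x F_0 ≤ c` and `Σ_{k} Σ_x F_{k+1} ≤ b` give `Σ_k Σ_x F_k ≤ c + b`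
(cell 43: "`Bound[Xi,Even,s] = Bound[Xi,0,s] + Bound[Xi,EvenTail,s]`"; cell 41: "`Bound[Xi,EvenTail,s] = Bound[Xi,2,s] + …`").
[cite: FitznerVanDerHofstad2017, notebook Percolation.nb cells 41 and 43 (transcript l.1139, l.1183)] -/
theorem NSumLE_cons {F : ℕ → Site d → ℝ} {c b : ℝ} (hc : SumLE (F 0) c)
    (hb : NSumLE (fun k x => F (k + 1) x) b) : NSumLE F (c + b) := by
  obtain ⟨hc1, hc2⟩ := hc
  obtain ⟨hb1, hb2, hb3⟩ := hb
  have h1 : ∀ k, Summable (F k) := fun k => by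
    cases k with
    | zero => exact hc1
    | succ k => exact hb1 k
  have h2 : Summable fun k => ∑' x, F k x :=
    (summable_nat_add_iff 1).1 (by simpa using hb2)
  refine ⟨h1, h2, ?_⟩
  rw [h2.tsum_eq_zero_add]
  exact add_le_add hc2 hb3

/-- Shifting the other way: dropping the first cell keeps an `NSumLE` bound (the tail of a convergent series of
non-negative terms is below the whole series). [folklore] -/
theorem NSumLE_succ {F : ℕ → Site d → ℝ} (h0 : ∀ k x, 0 ≤ F k x) {b : ℝ} (hb : NSumLE F b) :
    NSumLE (fun k x => F (k + 1) x) b := by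
  obtain ⟨hb1, hb2, hb3⟩ := hb
  have h2 : Summable fun k => ∑' x, F (k + 1) x := (summable_nat_add_iff 1).2 hb2
  refine ⟨fun k => hb1 (k + 1), h2, ?_⟩
  have h := hb2.tsum_eq_zero_add
  have h0' : 0 ≤ ∑' x, F 0 x := tsum_nonneg (h0 0)
  linarith

end PerN

/-! ## The parity series `Σ_a uᵀ B^{α+2a} A B̄^β w` as the `χ = kDelta` case of `Stage1Tails.ser` -/

section Parity

variable {n : Type*} [Fintype n] [DecidableEq n]

/-- The `(a, 0)` term of the series (⋆) is `uᵀ B^{α+2a} A B̄^β w`. [folklore] -/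
theorem term_zero_eq (u : n → ℝ) (B : Matrix n n ℝ) (α : ℕ) (A Bb : Matrix n n ℝ) (β : ℕ) (w : n → ℝ) (a : ℕ) :
    term u B α A Bb β w (a, 0) = u ⬝ᵥ ((B ^ (α + 2 * a) * A * Bb ^ β) *ᵥ w) := by
  simp only [term, pow_zero, mul_one, pow_add, pow_mul, sq]

/-- With `χ = kDelta` the coefficient of `(a, b)` vanishes off `b = 0` and is `ψ a` on it. [folklore] -/
theorem coef_kDelta_eq (ψ : ℕ → ℝ) (p : ℕ × ℕ) :
    coef false ψ kDelta p = if p.2 = 0 then ψ p.1 else 0 := by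
  rw [coef_false]; unfold kDelta; split_ifs <;> simp

/-- **`χ = [b = 0]` collapses the double series to the parity series**: `ser false kOne kDelta u B α A B̄ β w
= Σ'_a uᵀ B^{α+2a} A B̄^β w` (as `tsum`s; no convergence needed). [folklore] -/
theorem ser_kDelta_eq_tsum (u : n → ℝ) (B : Matrix n n ℝ) (α : ℕ) (A Bb : Matrix n n ℝ) (β : ℕ) (w : n → ℝ) :
    ser false kOne kDelta u B α A Bb β w = ∑' a, u ⬝ᵥ ((B ^ (α + 2 * a) * A * Bb ^ β) *ᵥ w) := by
  unfold ser
  have hinj : Function.Injective (fun a : ℕ => (a, 0)) := fun a b h => by simpa using h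
  have hsupp : Function.support (fun p : ℕ × ℕ => coef false kOne kDelta p * term u B α A Bb β w p)
      ⊆ Set.range (fun a : ℕ => (a, 0)) := by
    intro p hp
    rw [Function.mem_support, coef_kDelta_eq] at hp
    by_cases h : p.2 = 0
    · exact ⟨p.1, by ext <;> simp [h]⟩
    · exact absurd (by simp [h]) hp
  rw [← hinj.tsum_eq hsupp]
  refine tsum_congr fun a => ?_
  simp [coef_kDelta_eq, kOne, term_zero_eq]

/-- Under the Neumann certificate `(1 − B²) S = 1`, `0 ≤ S` (and non-negative ingredients) the parity series converges
and is below the closed form `uᵀ B^α (S A) B̄^β w` (`Σ_a B^{2a} ≤ S` entrywise: `Stage1Tails.cert_one`; the `B̄` side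
carries no geometric sum: `cert_delta`). [folklore] -/
theorem summable_term_zero_and_tsum_le {u w : n → ℝ} {B A Bb S : Matrix n n ℝ} (h : NN u B A Bb w)
    (hS0 : ∀ i j, 0 ≤ S i j) (hS : (1 - B * B) * S = 1) (α β : ℕ) :
    Summable (fun a => u ⬝ᵥ ((B ^ (α + 2 * a) * A * Bb ^ β) *ᵥ w)) ∧
      ∑' a, u ⬝ᵥ ((B ^ (α + 2 * a) * A * Bb ^ β) *ᵥ w) ≤ u ⬝ᵥ ((B ^ α * (S * A) * Bb ^ β) *ᵥ w) := by
  have hL := cert_one (mul_apply_nonneg h.B h.B) hS0 hS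
  have hR : ∀ N i j, (∑ b ∈ Finset.range N, kDelta b • (Bb * Bb) ^ b) i j ≤ (1 : Matrix n n ℝ) i j :=
    fun N i j => cert_delta (Bb * Bb) N i j
  obtain ⟨hsum, hle⟩ := ser_le kOne_nonneg kDelta_nonneg h hL hR α β
  have hinj : Function.Injective (fun a : ℕ => (a, 0)) := fun a b h' => by simpa using h'
  have hsum' : Summable (fun a => u ⬝ᵥ ((B ^ (α + 2 * a) * A * Bb ^ β) *ᵥ w)) := by
    refine (hsum.comp_injective hinj).congr fun a => ?_
    simp [Function.comp_apply, coef_kDelta_eq, kOne, term_zero_eq]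
  refine ⟨hsum', ?_⟩
  rw [← ser_kDelta_eq_tsum]
  simpa only [mul_one] using hle

end Parity

/-! ## The glue: per-`N` parity bounds ⇒ `NSumLE` with the `Stage1Tails` reading as the bound -/

section Glue

variable {d : ℕ} {n : Type*} [Fintype n] [DecidableEq n]

/-- **Remark 2.3 / (5.34)–(5.37) summed over `N` of fixed parity, typed.**  Let `G_a` (`a ≥ 0`) be non-negative
functions on sites (`G_a = Ξ^{(2a+4)}`, `Ξ^{(2a+5)}`, `Ξ^{(2a+4),ι}`, …) obeying the per-`N` bounds of the engine's
output shape `Σ'_x G_a(x) ≤ uᵀ B^{α+2a} A B̄^β w` ("`Ξ̂^{(N)}_p(0) ≤ P⃗^S (B^ι)^{N−1} Ā^ι P⃗^E`", `N − 1 = α + 2a`), with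
entrywise non-negative `u, B, A, B̄, w` and a Neumann certificate `(1 − B²) S = 1`, `0 ≤ S`.  Then
`Σ_a Σ_x G_a(x)` converges, is at most the series `ser false kOne kDelta u B α A B̄ β w` (the cell-41 symbol
`Σ_j e_j^α/(1−e_j²) v_j.A.w` read as a series), and that series is at most the closed form `uᵀ B^α (S A) B̄^β w`
("The sum of this over `N` is computed using the geometric sum").
[cite: FitznerVanDerHofstad2017, Remark 2.3 (arXiv:1506.07977v2 pp. 12–13); Prop. 5.5 (5.34), Prop. 5.6 (5.37) (p. 53); notebook Percolation.nb cell 41 (transcript l.1139–1142)] -/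
theorem NSumLE_of_parityBounds {G : ℕ → Site d → ℝ} (h0 : ∀ a x, 0 ≤ G a x)
    {u w : n → ℝ} {B A Bb S : Matrix n n ℝ} (h : NN u B A Bb w)
    (hS0 : ∀ i j, 0 ≤ S i j) (hS : (1 - B * B) * S = 1) (α β : ℕ)
    (hG : ∀ a, Summable (G a) ∧ ∑' x, G a x ≤ u ⬝ᵥ ((B ^ (α + 2 * a) * A * Bb ^ β) *ᵥ w)) :
    NSumLE G (ser false kOne kDelta u B α A Bb β w) ∧
      ser false kOne kDelta u B α A Bb β w ≤ u ⬝ᵥ ((B ^ α * (S * A) * Bb ^ β) *ᵥ w) := by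
  obtain ⟨hsum, hle⟩ := summable_term_zero_and_tsum_le h hS0 hS α β
  refine ⟨?_, ?_⟩
  · rw [ser_kDelta_eq_tsum]
    exact NSumLE_of_perN h0 hG hsum
  · rw [ser_kDelta_eq_tsum]
    exact hle

/-- The same with the closed-form majorant as the bound (the `Reading.closed S S̄` value of a one-piece unweighted
table: `Kind.one.L S = S` on the `B` side, `Kind.delta.L S̄ = 1` on the `B̄` side). [cite: FitznerVanDerHofstad2017, Remark 2.3 (arXiv:1506.07977v2 pp. 12–13); notebook Percolation.nb cell 41 (transcript l.1139–1142)] -/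
theorem NSumLE_closed_of_parityBounds {G : ℕ → Site d → ℝ} (h0 : ∀ a x, 0 ≤ G a x)
    {u w : n → ℝ} {B A Bb S : Matrix n n ℝ} (h : NN u B A Bb w)
    (hS0 : ∀ i j, 0 ≤ S i j) (hS : (1 - B * B) * S = 1) (α β : ℕ)
    (hG : ∀ a, Summable (G a) ∧ ∑' x, G a x ≤ u ⬝ᵥ ((B ^ (α + 2 * a) * A * Bb ^ β) *ᵥ w)) :
    NSumLE G (u ⬝ᵥ ((B ^ α * (S * A) * Bb ^ β) *ᵥ w)) := by
  obtain ⟨h1, h2⟩ := NSumLE_of_parityBounds h0 h hS0 hS α β hG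
  exact ⟨h1.1, h1.2.1, h1.2.2.trans h2⟩

/-- **The `…Tail` fields.**  `F_k` (`k ≥ 0`; `F_k = Ξ^{(2k+2)}` for `EvenTail`, `Ξ^{(2k+3)}` for `OddTail`) with an
explicit bound `Σ_x F_0 ≤ c` on the first cell (`Bound[Xi,2,s]`, `Bound[Xi,3,s]`) and the parity bounds
`Σ'_x F_{a+1}(x) ≤ uᵀ B^{α+2a} A B̄^β w` on the rest: `NSumLE F (c + ser false kOne kDelta u B α A B̄ β w)` — cell 41
"`Bound[Xi,EvenTail,s] = Bound[Xi,2,s] + Σ_j e_j³/(1−e_j²) v_j.AiotabarNonRep.PE`" (α = 3),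
"`Bound[Xi,OddTail,s] = Bound[Xi,3,s] + Σ_j e_j⁴/(1−e_j²) v_j.AiotabarNonRep.PE`" (α = 4).
[cite: FitznerVanDerHofstad2017, notebook Percolation.nb cell 41 (transcript l.1139–1142); Prop. 5.5 (5.34), Prop. 5.6 (5.37) (arXiv:1506.07977v2 p. 53)] -/
theorem NSumLE_tail_of_parityBounds {F : ℕ → Site d → ℝ} (h0 : ∀ k x, 0 ≤ F k x) {c : ℝ} (hc : SumLE (F 0) c)
    {u w : n → ℝ} {B A Bb S : Matrix n n ℝ} (h : NN u B A Bb w)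
    (hS0 : ∀ i j, 0 ≤ S i j) (hS : (1 - B * B) * S = 1) (α β : ℕ)
    (hF : ∀ a, Summable (F (a + 1)) ∧ ∑' x, F (a + 1) x ≤ u ⬝ᵥ ((B ^ (α + 2 * a) * A * Bb ^ β) *ᵥ w)) :
    NSumLE F (c + ser false kOne kDelta u B α A Bb β w) ∧
      ser false kOne kDelta u B α A Bb β w ≤ u ⬝ᵥ ((B ^ α * (S * A) * Bb ^ β) *ᵥ w) := by
  obtain ⟨h1, h2⟩ := NSumLE_of_parityBounds (G := fun a x => F (a + 1) x) (fun a x => h0 (a + 1) x) h hS0 hS α β hF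
  exact ⟨NSumLE_cons hc h1, h2⟩

/-- **The four unweighted rows of one family at once** (cells 41/43 for `Ξ`, and alike for `Ξ^ι` at each `ι`):
from the four explicit cells `Σ_x Ξ^{(N)} ≤ c_N` (`N = 0,…,3`: `Bound[Xi,0..3,s]`) and per-`N` bounds of the shape of
(5.34)/(5.37) for every `N ≥ 4`, `Σ'_x Ξ^{(N)}(x) ≤ uᵀ B^{N−1} A w`, with non-negative ingredients and the Neumann
certificate: `EvenTail = c₂ + [α = 3 series]`, `OddTail = c₃ + [α = 4 series]`, `Even = c₀ + EvenTail`,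
`Odd = c₁ + OddTail` as `NSumLE` bounds on `k ↦ Ξ^{(2k+2)}`, `Ξ^{(2k+3)}`, `Ξ^{(2k)}`, `Ξ^{(2k+1)}`
(`Absolut = Odd + Even` is the interleaving `NobleKSpaceRewritePhi.NSumLE_of_even_odd`, not repeated here).
[cite: FitznerVanDerHofstad2017, Prop. 5.5 (5.34), Prop. 5.6 (5.37) (arXiv:1506.07977v2 p. 53); Remark 2.3 (pp. 12–13); notebook Percolation.nb cells 41, 43 (transcript l.1139–1142, l.1183–1185)] -/
theorem NSumLE_rows_of_bounds {Ξ : ℕ → Site d → ℝ} (h0 : ∀ N x, 0 ≤ Ξ N x) {c₀ c₁ c₂ c₃ : ℝ}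
    (hc₀ : SumLE (Ξ 0) c₀) (hc₁ : SumLE (Ξ 1) c₁) (hc₂ : SumLE (Ξ 2) c₂) (hc₃ : SumLE (Ξ 3) c₃)
    {u w : n → ℝ} {B A Bb S : Matrix n n ℝ} (h : NN u B A Bb w)
    (hS0 : ∀ i j, 0 ≤ S i j) (hS : (1 - B * B) * S = 1)
    (hN : ∀ N, 4 ≤ N → Summable (Ξ N) ∧ ∑' x, Ξ N x ≤ u ⬝ᵥ ((B ^ (N - 1) * A) *ᵥ w)) :
    NSumLE (fun k x => Ξ (2 * k + 2) x) (c₂ + ser false kOne kDelta u B 3 A Bb 0 w) ∧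
      NSumLE (fun k x => Ξ (2 * k + 3) x) (c₃ + ser false kOne kDelta u B 4 A Bb 0 w) ∧
      NSumLE (fun k x => Ξ (2 * k) x) (c₀ + (c₂ + ser false kOne kDelta u B 3 A Bb 0 w)) ∧
      NSumLE (fun k x => Ξ (2 * k + 1) x) (c₁ + (c₃ + ser false kOne kDelta u B 4 A Bb 0 w)) ∧
      ser false kOne kDelta u B 3 A Bb 0 w ≤ u ⬝ᵥ ((B ^ 3 * (S * A)) *ᵥ w) ∧
      ser false kOne kDelta u B 4 A Bb 0 w ≤ u ⬝ᵥ ((B ^ 4 * (S * A)) *ᵥ w) := by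
  -- the per-`N` bounds along the two progressions `N = 2a + 4` and `N = 2a + 5`
  have hE : ∀ a, Summable ((fun k x => Ξ (2 * k + 2) x) (a + 1)) ∧
      ∑' x, (fun k x => Ξ (2 * k + 2) x) (a + 1) x ≤ u ⬝ᵥ ((B ^ (3 + 2 * a) * A * Bb ^ 0) *ᵥ w) := fun a => by
    obtain ⟨hs, hle⟩ := hN (2 * (a + 1) + 2) (by omega)
    have e : 2 * (a + 1) + 2 - 1 = 3 + 2 * a := by omega
    rw [e] at hle
    exact ⟨hs, by simpa only [pow_zero, Matrix.mul_one] using hle⟩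
  have hO : ∀ a, Summable ((fun k x => Ξ (2 * k + 3) x) (a + 1)) ∧
      ∑' x, (fun k x => Ξ (2 * k + 3) x) (a + 1) x ≤ u ⬝ᵥ ((B ^ (4 + 2 * a) * A * Bb ^ 0) *ᵥ w) := fun a => by
    obtain ⟨hs, hle⟩ := hN (2 * (a + 1) + 3) (by omega)
    have e : 2 * (a + 1) + 3 - 1 = 4 + 2 * a := by omega
    rw [e] at hle
    exact ⟨hs, by simpa only [pow_zero, Matrix.mul_one] using hle⟩
  obtain ⟨hET, hE3⟩ := NSumLE_tail_of_parityBounds (F := fun k x => Ξ (2 * k + 2) x)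
    (fun k x => h0 _ x) hc₂ h hS0 hS 3 0 hE
  obtain ⟨hOT, hO4⟩ := NSumLE_tail_of_parityBounds (F := fun k x => Ξ (2 * k + 3) x)
    (fun k x => h0 _ x) hc₃ h hS0 hS 4 0 hO
  refine ⟨hET, hOT, ?_, ?_, ?_, ?_⟩
  · exact NSumLE_cons (F := fun k x => Ξ (2 * k) x) hc₀ (by simpa only [mul_add, mul_one] using hET)
  · exact NSumLE_cons (F := fun k x => Ξ (2 * k + 1) x) hc₁ (by simpa only [mul_add, mul_one] using hOT)
  · simpa only [pow_zero, Matrix.mul_one] using hE3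
  · simpa only [pow_zero, Matrix.mul_one] using hO4

/-- The value of a one-piece table of `Stage1Tails` in the series reading is the series of this module
(`total Reading.series I [π] = π.c · ser π.drop π.ψ.c π.χ.c …`); for the four unweighted tables (`c = 1`, `drop = false`,
kinds `one/delta`) this is `ser false kOne kDelta (I.u π.u) I.B π.α (I.m π.M) I.Bb π.β (I.w π.w)`. [folklore] -/
theorem total_singleton_series (I : Ingr n) (π : Piece) :
    total Reading.series I [π]
      = (π.c : ℝ) * ser π.drop π.ψ.c π.χ.c (I.u π.u) I.B π.α (I.m π.M) I.Bb π.β (I.w π.w) := by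
  simp [total, Piece.val, Reading.series]

/-- In particular for the table `Tail.xiEven` (one piece, `c = 1`, `α = 3`, `β = 0`, kinds `one`, `delta`). [cite: FitznerVanDerHofstad2017, notebook Percolation.nb cell 41 (transcript l.1139)] -/
theorem total_xiEven_series (I : Ingr n) :
    total Reading.series I Tail.xiEven = ser false kOne kDelta (I.u .PS) I.B 3 (I.m .AbarNR) I.Bb 0 (I.w .PE) := by
  rw [Tail.xiEven, total_singleton_series]; simp [Kind.c]

/-- … for `Tail.xiOdd` (`α = 4`). [cite: FitznerVanDerHofstad2017, notebook Percolation.nb cell 41 (transcript l.1140)] -/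
theorem total_xiOdd_series (I : Ingr n) :
    total Reading.series I Tail.xiOdd = ser false kOne kDelta (I.u .PS) I.B 4 (I.m .AbarNR) I.Bb 0 (I.w .PE) := by
  rw [Tail.xiOdd, total_singleton_series]; simp [Kind.c]

/-- … for `Tail.xiIotaEven` (`u = P^ι`, `α = 3`). [cite: FitznerVanDerHofstad2017, notebook Percolation.nb cell 41 (transcript l.1141)] -/
theorem total_xiIotaEven_series (I : Ingr n) :
    total Reading.series I Tail.xiIotaEven = ser false kOne kDelta (I.u .Piota) I.B 3 (I.m .AbarNR) I.Bb 0 (I.w .PE) := by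
  rw [Tail.xiIotaEven, total_singleton_series]; simp [Kind.c]

/-- … for `Tail.xiIotaOdd` (`u = P^ι`, `α = 4`). [cite: FitznerVanDerHofstad2017, notebook Percolation.nb cell 41 (transcript l.1142)] -/
theorem total_xiIotaOdd_series (I : Ingr n) :
    total Reading.series I Tail.xiIotaOdd = ser false kOne kDelta (I.u .Piota) I.B 4 (I.m .AbarNR) I.Bb 0 (I.w .PE) := by
  rw [Tail.xiIotaOdd, total_singleton_series]; simp [Kind.c]

end Glue

end Literature.Probability.FitznerVanDerHofstad2017.NobleNSums

end
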